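import Mathlib
import HarnessLib
import Summits.AtomisticToContinuum.FouriersLaw.Theses.JunctionLocality
import Summits.AtomisticToContinuum.FouriersLaw.Theorems.JunctionLocalitySuperadditiveResistanceStubInsertionIdentity
import Summits.AtomisticToContinuum.FouriersLaw.Theorems.JunctionLocalitySuperadditiveResistanceFarTransmissionHelpers
import Summits.AtomisticToContinuum.FouriersLaw.Theorems.JunctionLocalitySuperadditiveResistanceKuboFrame
import Summits.AtomisticToContinuum.FouriersLaw.Theorems.JunctionLocalitySuperadditiveResistanceStubLinearResponsePlain
import Summits.AtomisticToContinuum.FouriersLaw.Theorems.JunctionLocalitySuperadditiveResistanceStubJunctionCurvature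
import Summits.AtomisticToContinuum.FouriersLaw.Theorems.JunctionLocalitySuperadditiveResistanceTransferV4
import Summits.AtomisticToContinuum.FouriersLaw.Theorems.JunctionLocalitySuperadditiveResistanceTransferV4Signs

/-!
# Line `thermalise-then-cut-probe-insertion` — TRANSFER THEOREM of skeleton v4.2: the sign bet is only `u, v ≥ 0`
(crux `JunctionLocality.SuperadditiveResistance`, stmt-AtomisticToContinuum-11748; lead prover-line-stmt-AtomisticToContinuum-11748-c1-0,
2026-08-16)

v4.1 (`…TransferV4Signs`) mixed the two ends of the insertion identity under `u, v ≥ 0` and the bypass margin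
`x ≥ −ρ·min(u, v)`, `ρ < 1`. The margin is NOT an independent bet: the junction-curvature bet `‖S_K gb₁‖² ≤ C₃ a²` together with
the landed energy-channel floor `T²u²/γ⁴ ≤ ‖S_K gb₁‖²` (`energyChannel_le_curvature_of_kuboFrame`, p102456: the orthogonal split of
`S_K gb₁` along the pair's first even Hermite mode) gives `u ≤ c₀·a`, `c₀ = γ²√C₃⁺/T`, hence `x = a − u ≥ −(c₀/(c₀+1))·u`
(`bypass_lower_of_channel`, pure real algebra), and the mirror at bath 4; so `ρ = c₀/(c₀+1) < 1`.
`superadditiveResistance_of_lineBetsV4nonneg`: the five open v4.2 stubs (`stub_kuboFrame`, `stub_junctionRoughnessLTE`,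
`stub_junctionCurvature`, `stub_transferNonneg` = `u, v ≥ 0` only, `stub_terminationLocalityTC`, `stub_farTransmission`) as hypotheses
imply the crux BY NAME. No definitions, no named facts; standard axioms.
-/

noncomputable section

open MeasureTheory Filter Topology ProbabilityTheory
open scoped ContDiff NNReal
open Literature.MathematicalPhysics.KineticTheory.HeatConduction

namespace Summit.AtomisticToContinuum.FouriersLaw.Cruxes.SuperadditiveResistance.ThermaliseThenCutProbeInsertion

namespace TransferV4Nonneg

open TransferV4 (insertion_bound_abs selfLeft_eq_transfer_add_bypass selfRight_eq_transfer_add_bypass)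
open TransferV4Signs (alpha_leg_twoEnded_signs)

/-- **Bypass margin from the energy channel (pure real algebra; v4.2).** If `0 ≤ u ≤ c·a` (in squared form
`u² ≤ c²a²`, `a, c ≥ 0`) then `x = a − u ≥ −(c/(c+1))·u`: the `ρ < 1` margin of the two-ended elimination with `ρ = c/(c+1)`. -/
theorem bypass_lower_of_channel :
    ∀ {u a c : ℝ}, 0 ≤ u → 0 ≤ a → 0 ≤ c → u ^ 2 ≤ c ^ 2 * a ^ 2 → -(c / (c + 1) * u) ≤ a - u := by
  intro u a c hu ha hc h
  have hca : 0 ≤ c * a := mul_nonneg hc ha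
  have h' : u ≤ c * a := by
    have : u ^ 2 ≤ (c * a) ^ 2 := by rw [mul_pow]; exact h
    exact (sq_le_sq₀ hu hca).mp this
  have hc1 : 0 < c + 1 := by linarith
  rw [div_mul_eq_mul_div, neg_le, neg_sub, le_div_iff₀ hc1]
  nlinarith

/-- **TRANSFER THEOREM (skeleton v4.2).** The five open registered stubs of the line — `stub_kuboFrame`,
`stub_junctionRoughnessLTE`, `stub_junctionCurvature`, the PURE SIGN bet `stub_transferNonneg` (`u, v ≥ 0`),
`stub_terminationLocalityTC`, `stub_farTransmission` — as hypotheses, imply the crux `JunctionLocality.SuperadditiveResistance`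
BY NAME (`stub_linearResponsePlain` is the landed theorem p96604; the insertion identity is the landed `insertionIdentity_of_kuboFrame`).
Constant `C = 4c + 4K′ + 4K′(1+c) + 2`, `K′ = (2/(1−ρ))·γ²√(C₂⁺C₃⁺)`, `ρ = c₀/(c₀+1)`, `c₀ = γ²√C₃⁺/T`. -/
theorem superadditiveResistance_of_lineBetsV4nonneg :
    (∀ (ω₂ lam β γ T : ℝ), 0 < ω₂ → 0 < lam → 0 < β → 0 < γ → 0 < T →
        ∀ N M : ℕ, 2 ≤ N → 2 ≤ M →
          ∃ (g : Fin 4 → Fin 4 → ℝ) (gb₁ gb₄ : PhaseSpace (N + M) → ℝ),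
            KuboFrame (pinnedChain ω₂ lam β γ) T N M g gb₁ gb₄) →
    (∀ (ω₂ lam β γ : ℝ) (μ : (N : ℕ) → ℝ → ℝ → Measure (PhaseSpace N)) (T : ℝ) (D : ℕ → ℝ),
        CruxFrame ω₂ lam β γ μ T D →
        ∃ C₂ : ℝ, ∀ N M : ℕ, 2 ≤ N → 2 ≤ M →
          ∀ (h : PhaseSpace (N + M) → ℝ),
            PlainFrame (pinnedChain ω₂ lam β γ) T (N + M) h (D (N + M) / ((N : ℝ) + (M : ℝ) - 1)) →
            ∃ θ : ℝ, roughness (pinnedChain ω₂ lam β γ) T N M (fun x => h x - θ * eK T N M x) ≤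
              C₂ * (D (N + M) / ((N : ℝ) + (M : ℝ) - 1)) ^ 2) →
    (∀ (ω₂ lam β γ T : ℝ), 0 < ω₂ → 0 < lam → 0 < β → 0 < γ → 0 < T →
        ∃ C₃ : ℝ, ∀ N M : ℕ, 2 ≤ N → 2 ≤ M →
          ∀ (g : Fin 4 → Fin 4 → ℝ) (gb₁ gb₄ : PhaseSpace (N + M) → ℝ),
            KuboFrame (pinnedChain ω₂ lam β γ) T N M g gb₁ gb₄ →
            curvature (pinnedChain ω₂ lam β γ) T N M gb₁ ≤ C₃ * selfLeft g ^ 2 ∧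
            curvature (pinnedChain ω₂ lam β γ) T N M gb₄ ≤ C₃ * selfRight g ^ 2) →
    (∀ (ω₂ lam β γ T : ℝ), 0 < ω₂ → 0 < lam → 0 < β → 0 < γ → 0 < T →
        ∀ N M : ℕ, 2 ≤ N → 2 ≤ M →
          ∀ (g : Fin 4 → Fin 4 → ℝ) (gb₁ gb₄ : PhaseSpace (N + M) → ℝ),
            KuboFrame (pinnedChain ω₂ lam β γ) T N M g gb₁ gb₄ →
            0 ≤ transferLeft g ∧ 0 ≤ transferRight g) →
    (∀ (ω₂ lam β γ : ℝ) (μ : (N : ℕ) → ℝ → ℝ → Measure (PhaseSpace N)) (T : ℝ) (D : ℕ → ℝ),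
        CruxFrame ω₂ lam β γ μ T D →
        (∀ L : ℕ, 2 ≤ L → ∃ h : PhaseSpace L → ℝ,
            PlainFrame (pinnedChain ω₂ lam β γ) T L h (D L / ((L : ℝ) - 1))) →
        ∃ c : ℝ, ∀ N M : ℕ, 2 ≤ N → 2 ≤ M →
          ∀ (g : Fin 4 → Fin 4 → ℝ) (gb₁ gb₄ : PhaseSpace (N + M) → ℝ),
            KuboFrame (pinnedChain ω₂ lam β γ) T N M g gb₁ gb₄ →
            selfLeft g ≤ D N / ((N : ℝ) - 1) * (1 + c * (D N / ((N : ℝ) - 1))) ∧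
            selfRight g ≤ D M / ((M : ℝ) - 1) * (1 + c * (D M / ((M : ℝ) - 1)))) →
    (∀ (ω₂ lam β γ : ℝ) (μ : (N : ℕ) → ℝ → ℝ → Measure (PhaseSpace N)) (T : ℝ) (D : ℕ → ℝ),
        CruxFrame ω₂ lam β γ μ T D →
        (∀ L : ℕ, 2 ≤ L → ∃ h : PhaseSpace L → ℝ,
            PlainFrame (pinnedChain ω₂ lam β γ) T L h (D L / ((L : ℝ) - 1))) →
        ∃ c : ℝ, ∀ N M : ℕ, 2 ≤ N → 2 ≤ M →
          ∀ (g : Fin 4 → Fin 4 → ℝ) (gb₁ gb₄ : PhaseSpace (N + M) → ℝ),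
            KuboFrame (pinnedChain ω₂ lam β γ) T N M g gb₁ gb₄ →
            bypass g ≤ c * (D N / ((N : ℝ) - 1)) * (D M / ((M : ℝ) - 1))) →
    Summit.AtomisticToContinuum.FouriersLaw.Theses.JunctionLocality.SuperadditiveResistance := by
  intro hLRd hRO hCU hBD hTL hFT
  have hLRp := stub_linearResponsePlain
  have hID := insertionIdentity_of_kuboFrame
  intro ω₂ lam β γ hω hl hβ hγ hU μ hμ T hT D hD hpos
  have hF : CruxFrame ω₂ lam β γ μ T D := ⟨hω, hl, hβ, hγ, hU, hμ, hT, hD, hpos⟩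
  have hPlain := hLRp ω₂ lam β γ μ T D hF
  have hDev := hLRd ω₂ lam β γ T hω hl hβ hγ hT
  obtain ⟨C₂, hC₂⟩ := hRO ω₂ lam β γ μ T D hF
  obtain ⟨C₃, hC₃⟩ := hCU ω₂ lam β γ T hω hl hβ hγ hT
  have hρ := hBD ω₂ lam β γ T hω hl hβ hγ hT
  obtain ⟨c₁, hc₁⟩ := hTL ω₂ lam β γ μ T D hF hPlain
  obtain ⟨c₂, hc₂⟩ := hFT ω₂ lam β γ μ T D hF hPlain
  -- uniform constants
  obtain ⟨c, hc_def⟩ : ∃ c : ℝ, c = max (max c₁ c₂) 0 := ⟨_, rfl⟩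
  obtain ⟨K, hK_def⟩ : ∃ K : ℝ, K = γ ^ 2 * Real.sqrt (max C₂ 0 * max C₃ 0) := ⟨_, rfl⟩
  -- the bypass margin ρ = c₀/(c₀+1), c₀ = γ²√C₃⁺/T, from the energy-channel floor of the curvature bet
  obtain ⟨c₀, hc₀_def⟩ : ∃ c₀ : ℝ, c₀ = γ ^ 2 * Real.sqrt (max C₃ 0) / T := ⟨_, rfl⟩
  have hc₀ : 0 ≤ c₀ := by rw [hc₀_def]; positivity
  obtain ⟨ρ, hρ_def⟩ : ∃ ρ : ℝ, ρ = c₀ / (c₀ + 1) := ⟨_, rfl⟩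
  have hρ0 : 0 ≤ ρ := by rw [hρ_def]; positivity
  have hρ1 : ρ < 1 := by rw [hρ_def, div_lt_one (by linarith)]; linarith
  obtain ⟨K', hK'_def⟩ : ∃ K' : ℝ, K' = 2 / (1 - ρ) * K := ⟨_, rfl⟩
  have hc0 : 0 ≤ c := by rw [hc_def]; exact le_max_right _ _
  have hcc₁ : c₁ ≤ c := by rw [hc_def]; exact le_trans (le_max_left _ _) (le_max_left _ _)
  have hcc₂ : c₂ ≤ c := by rw [hc_def]; exact le_trans (le_max_right _ _) (le_max_left _ _)
  have hK0 : 0 ≤ K := by rw [hK_def]; positivity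
  have hρ1' : 0 < 1 - ρ := by linarith
  have hK'0 : 0 ≤ K' := by rw [hK'_def]; positivity
  refine ⟨4 * c + 4 * K' + 4 * K' * (1 + c) + 2, ?_⟩
  intro N M hN hM
  -- the response field of the whole chain and the device data of this split
  obtain ⟨h, hPF⟩ := hPlain (N + M) (by omega)
  obtain ⟨g, gb₁, gb₄, hDF⟩ := hDev N M hN hM
  have hcast : ((N + M : ℕ) : ℝ) - 1 = (N : ℝ) + (M : ℝ) - 1 := by push_cast; ring
  rw [hcast] at hPF
  -- conductances of the whole and of the pieces
  obtain ⟨gL, hgL⟩ : ∃ gL : ℝ, gL = D (N + M) / ((N : ℝ) + (M : ℝ) - 1) := ⟨_, rfl⟩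
  obtain ⟨gN, hgN⟩ : ∃ gN : ℝ, gN = D N / ((N : ℝ) - 1) := ⟨_, rfl⟩
  obtain ⟨gM, hgM⟩ : ∃ gM : ℝ, gM = D M / ((M : ℝ) - 1) := ⟨_, rfl⟩
  have hN' : (2 : ℝ) ≤ (N : ℝ) := by exact_mod_cast hN
  have hM' : (2 : ℝ) ≤ (M : ℝ) := by exact_mod_cast hM
  have hgN0 : 0 < gN := by rw [hgN]; exact div_pos (hpos N hN) (by linarith)
  have hgM0 : 0 < gM := by rw [hgM]; exact div_pos (hpos M hM) (by linarith)
  have hgL0 : 0 < gL := by rw [hgL]; exact div_pos (hpos (N + M) (by omega)) (by linarith)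
  -- the roughness bet picks the Gibbs shift θ₀
  obtain ⟨θ₀, hrough⟩ := hC₂ N M hN hM h hPF
  rw [← hgL] at hPF hrough
  have hsym : ∀ a b, g a b = g b a := hDF.1
  have hpsd : ∀ θ, 0 ≤ dirichletForm g θ := hDF.2.1
  have ha0 : 0 ≤ selfLeft g := selfLeft_nonneg hsym hpsd
  have hb0 : 0 ≤ selfRight g := selfRight_nonneg hsym hpsd
  -- α-LEG: the identity at θ₀, from both ends, with the two size bets, then the two-ended elimination
  obtain ⟨h1, h4⟩ := hID ω₂ lam β γ T hω hl hβ hγ hT N M hN hM h gL g gb₁ gb₄ hPF hDF θ₀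
  obtain ⟨hcurv₁, hcurv₄⟩ := hC₃ N M hN hM g gb₁ gb₄ hDF
  have hro0 : 0 ≤ roughness (pinnedChain ω₂ lam β γ) T N M (fun x => h x - θ₀ * eK T N M x) :=
    integral_nonneg fun _ => sq_nonneg _
  have hα₁ : |sideOne g θ₀ - gL| ≤ K * selfLeft g * gL := by
    rw [hK_def]; exact insertion_bound_abs ha0 hgL0.le hro0 h1 hcurv₁ hrough
  have hα₄ : |sideFour g θ₀ - gL| ≤ K * selfRight g * gL := by
    rw [hK_def]; exact insertion_bound_abs hb0 hgL0.le hro0 h4 hcurv₄ hrough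
  obtain ⟨hu0, hv0⟩ := hρ N M hN hM g gb₁ gb₄ hDF
  -- the ρ-margin of the bypass from the curvature bet through the landed energy-channel floor
  obtain ⟨hfl₁, hfl₄⟩ := energyChannel_le_curvature_of_kuboFrame hω hl.le hβ.le hγ hT (by omega) (by omega) hDF
  have hsq : Real.sqrt (max C₃ 0) ^ 2 = max C₃ 0 := Real.sq_sqrt (le_max_right _ _)
  have hC₃le : C₃ ≤ max C₃ 0 := le_max_left _ _
  have hT2 : 0 < T ^ 2 := by positivity
  have hγ4 : 0 < γ ^ 4 := by positivity
  have hch₁ : transferLeft g ^ 2 ≤ c₀ ^ 2 * selfLeft g ^ 2 := by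
    have h1 : T ^ 2 * transferLeft g ^ 2 / γ ^ 4 ≤ max C₃ 0 * selfLeft g ^ 2 :=
      hfl₁.trans (hcurv₁.trans (mul_le_mul_of_nonneg_right hC₃le (sq_nonneg _)))
    have e : c₀ ^ 2 * selfLeft g ^ 2 = γ ^ 4 / T ^ 2 * (max C₃ 0 * selfLeft g ^ 2) := by
      rw [hc₀_def, div_pow, mul_pow, hsq]; ring
    have h2 := mul_le_mul_of_nonneg_left h1 (le_of_lt (by positivity : (0:ℝ) < γ ^ 4 / T ^ 2))
    have e2 : γ ^ 4 / T ^ 2 * (T ^ 2 * transferLeft g ^ 2 / γ ^ 4) = transferLeft g ^ 2 := by field_simp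
    rw [e2] at h2; rw [e]; exact h2
  have hch₄ : transferRight g ^ 2 ≤ c₀ ^ 2 * selfRight g ^ 2 := by
    have h4 : T ^ 2 * transferRight g ^ 2 / γ ^ 4 ≤ max C₃ 0 * selfRight g ^ 2 :=
      hfl₄.trans (hcurv₄.trans (mul_le_mul_of_nonneg_right hC₃le (sq_nonneg _)))
    have e : c₀ ^ 2 * selfRight g ^ 2 = γ ^ 4 / T ^ 2 * (max C₃ 0 * selfRight g ^ 2) := by
      rw [hc₀_def, div_pow, mul_pow, hsq]; ring
    have h5 := mul_le_mul_of_nonneg_left h4 (le_of_lt (by positivity : (0:ℝ) < γ ^ 4 / T ^ 2))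
    have e2 : γ ^ 4 / T ^ 2 * (T ^ 2 * transferRight g ^ 2 / γ ^ 4) = transferRight g ^ 2 := by field_simp
    rw [e2] at h5; rw [e]; exact h5
  have hxu : -(ρ * transferLeft g) ≤ bypass g := by
    have := bypass_lower_of_channel hu0 ha0 hc₀ hch₁
    rw [selfLeft_eq_transfer_add_bypass] at this
    rw [hρ_def]; linarith
  have hxv : -(ρ * transferRight g) ≤ bypass g := by
    have := bypass_lower_of_channel hv0 hb0 hc₀ hch₄
    rw [selfRight_eq_transfer_add_bypass] at this
    rw [hρ_def]; linarith
  have hdom : -(ρ * min (transferLeft g) (transferRight g)) ≤ bypass g := by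
    rcases le_total (transferLeft g) (transferRight g) with huv | hvu
    · rw [min_eq_left huv]; exact hxu
    · rw [min_eq_right hvu]; exact hxv
  have hα : gL - deviceConductance g ≤ K' * min (selfLeft g) (selfRight g) * gL := by
    rw [hK'_def]
    exact alpha_leg_twoEnded_signs hgL0.le hK0 hρ0 hρ1 hu0 hv0 hdom hα₁ hα₄
  -- β-LEG: the Dirichlet principle and the one-sided termination/transmission bets
  have hDir := deviceConductance_le hsym hpsd
  obtain ⟨hTLa, hTLb⟩ := hc₁ N M hN hM g gb₁ gb₄ hDF
  have hxup := hc₂ N M hN hM g gb₁ gb₄ hDF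
  rw [← hgN] at hTLa hxup
  rw [← hgM] at hTLb hxup
  have ha : selfLeft g ≤ gN * (1 + c * gN) :=
    hTLa.trans (mul_le_mul_of_nonneg_left
      ((add_le_add_iff_left 1).mpr (mul_le_mul_of_nonneg_right hcc₁ hgN0.le)) hgN0.le)
  have hb : selfRight g ≤ gM * (1 + c * gM) :=
    hTLb.trans (mul_le_mul_of_nonneg_left
      ((add_le_add_iff_left 1).mpr (mul_le_mul_of_nonneg_right hcc₁ hgM0.le)) hgM0.le)
  have hx : bypass g ≤ c * gN * gM :=
    hxup.trans (mul_le_mul_of_nonneg_right (mul_le_mul_of_nonneg_right hcc₂ hgN0.le) hgM0.le)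
  -- the real-analysis core
  have key := FarTransmission.core_estimate_unsigned' hgN0 hgM0 hgL0 hK'0 hc0 ha hb hx hα hDir
  rw [hgN, hgM, hgL, one_div_div, one_div_div, one_div_div] at key
  exact key


end TransferV4Nonneg

end Summit.AtomisticToContinuum.FouriersLaw.Cruxes.SuperadditiveResistance.ThermaliseThenCutProbeInsertion

end
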